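import Literature.NumberTheory.EllipticCurves.ZpExtensionEisensteinResidualKernelProofs
import Literature.NumberTheory.EllipticCurves.ZpExtensionEisensteinDVRSetting
import Literature.NumberTheory.GaloisCohomology.Howard2004.TransportConnectingKernelProofs
import HarnessLib

/-!
# Howard's H.5(b) for the curve's Eisenstein setting at the places `v ∈ S` away from `p`, bottom level
# (theorems only)

`Proofs` file (theorems only; no definition, no named fact, no instance, no `sorry`).  Topic `NumberTheory/EllipticCurves`
(D1 road of cell `pub/bsd-print-x9`; Howard's hypothesis **H.5(b)** [B. Howard, Compositio Math. 140 (2004), §1.3,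
arXiv:1202.6340 p. 7 L96–97: «the condition `F` propagated to `T̄` is stable under the action of `G_ℚ`»] for the
Eisenstein specialisation `(T_𝔮, F_𝔮)` of `E_K` (`WeierstrassCurve.eisensteinDVRSetting`), memo
`HOME/x9-p1-w3/H5B-AT-S-PLAN-w3g5.md`, step (A3); companion of D1's `…DVRSettingH5bReductionProofs` (the clause holds off `S`)
and of x9-p1-w3 g4's `PropagateTowerProofs` (the clause is level-invariant: level `0` suffices)).

* §1 **`IsQuotientBy.map_thetaH1_comp_transportH1_propagateStructure_eq_of_ker`** — the `v`-clause of H.5(b) when the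
  propagated condition is, at `v` and at `σ v`, the KERNEL `ker (H¹(K_w, T̄) → H¹(K_w, T))` of `H¹` of an equivariant
  `j : T̄ → T` compatible with `G_ℚ`-structures `θ` on `T̄` and `Θ₁` on `T` (`Howard2004/TransportConnectingKernelProofs`).
* §2 **`WeierstrassCurve.eisensteinDVRSetting_h5b_clause_zero_of_mem`** — for the curve's Eisenstein setting with ANY
  conjugation datum `cd` with respect to which `κ` is anticyclotomic (`κ(τ⁻¹gτ) = −κ(g)`), at tower level `0`
  (`T^{(0)} = E[p] ⊗ A_{m,1}(ψ)`, `T̄ = E[p]`, `θ = τ_*`), and a place `v ∈ S` with `p ∉ v`, `σ v ∈ S`, `p ∉ σ v`: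
  **if the local towers at `v` and at `σ v` are uniformly torsion ((UT): `p^c • H¹(K_w, E[p^j] ⊗ A_{m,j}(ψ)) = 0` for all
  `j`, D1's (hTX)) and their local invariants are killed by `[T]^{m-1}` ((SB); from the Cayley–Hamilton bound, `m` large),
  then `(θ_v ∘ transport_v)(F̄_𝔮(σ v)) = F̄_𝔮(v)`** — the `hfin` clause of `eisensteinDVRSetting_h5b_of` at `k = 0`.  Proof:
  both propagated conditions are `ker H¹(j)` for `j = ×[T]^{m-1} : E[p] ↪ E[p] ⊗ A_{m,1}` (`…ResidualKernelProofs`) and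
  `E[p] ⊗ A_{m,1}(ψ)` carries the `G_ℚ`-structure `(−1)^{m-1}(ι ⊗ τ)` extending `τ_*` (`…BottomConjugationProofs`).

Why only for `m` large and not a formality: `Tw(T_𝔮) ≅ T_{ι𝔮} ≇ T_𝔮` (no `G_ℚ`-structure on `T_𝔮/p^j`, `j ≥ 2`); the
clause is a rigidity statement, reduced here to the characteristic-`p` bottom level where `ι` acts.  No summit statement is
proved; BSD is not proved by any of this.  Seat `bsd-line-x9-p1-w3` g5.

References: [Howard2004HeegnerKolyvagin] §1.3 H.5(b), Def. 3.1.2, §3.2 (arXiv:1202.6340 p. 7 L96–97, p. 15, p. 16);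
[MazurRubinMemoirs2004] Def. 1.1.1, Example 1.1.2; [SerreGaloisCohomology1997] I §2.2, §2.4.
-/

set_option autoImplicit false

noncomputable section

open Function NumberField IsDedekindDomain Field
open scoped NumberField ContRepresentation TensorProduct Classical

namespace Literature.NumberTheory.EllipticCurves

open Literature.NumberTheory.GaloisRepresentations
open Literature.NumberTheory.GaloisCohomology.Howard2004

/-! ## §1 The kernel form of the clause -/

/-- **H.5(b) at `v` for KERNEL conditions.**  If the condition propagated to `T̄` is `ker H¹(K_v, j)` at `v` and
`ker H¹(K_{σv}, j)` at `σ v` for an equivariant `j : T̄ → T` and `T` carries an additive bijection `Θ₁` intertwining the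
`τ`-conjugate action with the action, compatible with `j` and `θ` (`Θ₁ ∘ j = j ∘ θ`), then
`(θ_v ∘ transport_v)(F̄(σ v)) = F̄(v)`. [cite: Howard2004HeegnerKolyvagin, §1.3 H.5(b) (arXiv:1202.6340 p. 7 L96–97)]
[cite: SerreGaloisCohomology1997, Ch. I §2.4] -/
theorem _root_.Literature.NumberTheory.GaloisCohomology.Howard2004.IsQuotientBy.map_thetaH1_comp_transportH1_propagateStructure_eq_of_ker
    {K : Type} [Field K] [NumberField K] {M : Type} [AddCommGroup M] [TopologicalSpace M] [DiscreteTopology M]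
    {R : Type} [CommRing R] [Module R M] {cd : ConjugationDatum K} {Nbar : Type} [AddCommGroup Nbar]
    [TopologicalSpace Nbar] [DiscreteTopology Nbar] [Module R Nbar] {ρ : DiscreteGaloisModule K M} {I : Ideal R}
    {ρbar : DiscreteGaloisModule K Nbar} {πbar : M →ₗ[R] Nbar}
    (h : IsQuotientBy ρ I ρbar πbar) (A : ResidualTau (R := R) cd ρbar) (𝓕 : DiscreteGaloisModule.SelmerStructure ρ)
    (jg : ρbar.toContRepresentation →ⁱL ρ.toContRepresentation) (Θ₁ : M →+ M)
    (hΘ₁ : ∀ (g : absoluteGaloisGroup K) (x : M), Θ₁ (ρ (cd.conj g) x) = ρ g (Θ₁ x)) (hΘ₁b : Function.Bijective Θ₁)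
    (hΘj : ∀ x, Θ₁ (jg x) = jg (A.θ x)) {v : HeightOneSpectrum (𝓞 K)}
    (hv : h.propagateStructure 𝓕 (Sum.inr v) = (galoisCohomology.map (DiscreteGaloisModule.localMap jg (Sum.inr v)) 1).ker)
    (hσv : h.propagateStructure 𝓕 (Sum.inr (cd.σ • v)) =
      (galoisCohomology.map (DiscreteGaloisModule.localMap jg (Sum.inr (cd.σ • v))) 1).ker) :
    ((h.propagateStructure 𝓕) (Sum.inr (cd.σ • v))).map ((A.thetaH1 (Sum.inr v)).comp (cd.transportH1 ρbar v)) =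
      (h.propagateStructure 𝓕) (Sum.inr v) := by
  rw [hσv, hv]
  exact map_thetaH1_comp_transportH1_ker_eq cd ρbar ρ A jg Θ₁ hΘ₁ hΘ₁b hΘj v

end Literature.NumberTheory.EllipticCurves

/-! ## §2 The curve: H.5(b) at the bottom level for `v ∈ S`, `v ∤ p`, under (UT) and (SB) -/

namespace WeierstrassCurve

open Literature.NumberTheory.EllipticCurves Literature.NumberTheory.GaloisRepresentations
open Literature.NumberTheory.GaloisRepresentations.DiscreteGaloisModule
open Literature.NumberTheory.GaloisCohomology.Howard2004
open Literature.NumberTheory.EllipticCurves.ZpExtension (EisensteinLevel)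
open Literature.NumberTheory.EllipticCurves.IwasawaAlgebra

variable {K : Type} [Field K] [NumberField K] (W : WeierstrassCurve ℚ) [W.IsElliptic] {p : ℕ} [hp : Fact p.Prime]
  (κ : ZpExtension K p) {m : ℕ} (hm : 1 ≤ m)
  (S : Finset (HeightOneSpectrum (𝓞 K)))
  (hpS : ∀ v : HeightOneSpectrum (𝓞 K), ((p : ℕ) : 𝓞 K) ∈ v.asIdeal → v ∈ S)
  (hbad : ∀ v : HeightOneSpectrum (𝓞 K), v ∉ S → ((p : ℕ) : 𝓞 K) ∉ v.asIdeal → (W.baseChange K).HasGoodReductionAt v)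
  (L : Set (HeightOneSpectrum (𝓞 K)))
  (hL : letI := IwasawaAlgebra.isLocalRing_quotient_X_pow_add_C p hm
    L ⊆ (W.eisensteinTower κ hm).degreeTwoPrimes p)
  (hLS : ∀ v ∈ L, v ∉ S)
  (jbar : AlgebraicClosure K →+* ℂ) (cd : ConjugationDatum K)
  (D : letI := IwasawaAlgebra.isLocalRing_quotient_X_pow_add_C p hm
    ∀ k, DualityDatum p cd ((W.eisensteinTower κ hm).ρ k) (IwasawaAlgebra.EisensteinCoeff p m (k + 1)))
  (fs : letI := IwasawaAlgebra.isLocalRing_quotient_X_pow_add_C p hm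
    ∀ (k : ℕ) (n : Finset (HeightOneSpectrum (𝓞 K))) (v : HeightOneSpectrum (𝓞 K)),
      galoisCohomology ((W.eisensteinLevelQuot κ hm k n).toLocal (Sum.inr v)) 1 →+
        SingularQuotient (GaloisRep.toLocal v (W.eisensteinLevelQuot κ hm k n)) ⊗[ℤ] Gell v)

set_option maxHeartbeats 800000 in
/-- **H.5(b), bottom level, at `v ∈ S` away from `p`, under (UT) and (SB) — generic residual presentation.**  For the
curve's Eisenstein tower `E[p^j] ⊗ A_{m,j}(ψ)`, ANY presentation `π̄ : E[p^1] ⊗ A_{m,1}(ψ) ↠ E[p]` by `([T])` (`E[p]` an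
`A_{m,1}`-module through the residue character) and ANY `G_ℚ`-structure `A` on `E[p]` with `π̄(1 ⊗ τ_* a) = A.θ (π̄ (1 ⊗ a))`
(`τ_* = cd.isLift.torsionMap`), a conjugation datum `cd` for which `κ` is anticyclotomic, and a place `v ∈ S`, `p ∉ v`,
`σ v ∈ S`, `p ∉ σ v` at which (and at whose conjugate) the local towers are uniformly torsion (UT) with `[T]^{m-1}`-torsion
invariants (SB): `(θ_v ∘ transport_v)(F̄_𝔮(σ v)) = F̄_𝔮(v)`.
[cite: Howard2004HeegnerKolyvagin, §1.3 H.5(b) and Def. 3.1.2 (arXiv:1202.6340 p. 7 L96–97, p. 15 L99–108)]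
[cite: MazurRubinMemoirs2004, Def. 1.1.1 and Example 1.1.2] -/
theorem eisensteinSelmerStructure_h5b_clause_one_of_mem
    [Module (EisensteinCoeff p m 1) (geomTorsion (W.baseChange K) (p : ℤ))]
    (hN : ∀ (d : EisensteinCoeff p m 1) (n : geomTorsion (W.baseChange K) (p : ℤ)),
      d • n = (EisensteinCoeff.residueChar p hm (le_refl 1) d).val • n)
    (πbar : EisensteinCoeff.Twisted p m 1 (geomTorsion (W.baseChange K) ((p : ℤ) ^ 1)) →ₗ[EisensteinCoeff p m 1]
      geomTorsion (W.baseChange K) (p : ℤ))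
    (hbar : IsQuotientBy (κ.eisensteinTwist ((W.baseChange K).torsionGaloisModule ((p : ℤ) ^ 1)) hm 1)
      (@IsLocalRing.maximalIdeal _ _ (EisensteinCoeff.isLocalRing_eisensteinCoeff p hm (le_refl 1)))
      ((W.baseChange K).torsionGaloisModule (p : ℤ)) πbar)
    (A : ResidualTau (R := EisensteinCoeff p m 1) cd ((W.baseChange K).torsionGaloisModule (p : ℤ)))
    (hone : ∀ a : geomTorsion (W.baseChange K) ((p : ℤ) ^ 1),
      πbar (EisensteinCoeff.Twisted.tmul 1 (cd.isLift.torsionMap W ((p : ℤ) ^ 1) a)) =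
        A.θ (πbar (EisensteinCoeff.Twisted.tmul 1 a)))
    (hanti : ∀ g : absoluteGaloisGroup K, (κ (cd.conj g)).toAdd = -(κ g).toAdd)
    {v : HeightOneSpectrum (𝓞 K)} (hvS : v ∈ S) (hpv : ((p : ℕ) : 𝓞 K) ∉ v.asIdeal) (hσvS : cd.σ • v ∈ S)
    (hpσv : ((p : ℕ) : 𝓞 K) ∉ (cd.σ • v).asIdeal) {c : ℕ}
    (hUT : ∀ w ∈ ({v, cd.σ • v} : Set (HeightOneSpectrum (𝓞 K))), ∀ (j : ℕ)
      (y : galoisCohomology ((κ.eisensteinTwist ((W.baseChange K).torsionGaloisModule ((p : ℤ) ^ j)) hm j).toLocal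
        (Sum.inr w)) 1), p ^ c • y = 0)
    (hSB : ∀ w ∈ ({v, cd.σ • v} : Set (HeightOneSpectrum (𝓞 K))), ∀ (j : ℕ)
      (x : EisensteinCoeff.Twisted p m j (geomTorsion (W.baseChange K) ((p : ℤ) ^ j))),
      (∀ g : absoluteGaloisGroup (w.adicCompletion K),
        ((κ.eisensteinTwist ((W.baseChange K).torsionGaloisModule ((p : ℤ) ^ j)) hm j).toLocal (Sum.inr w)) g x = x) →
        ((Ideal.Quotient.mk _ PowerSeries.X : EisensteinCoeff p m j) ^ (m - 1)) • x = 0) :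
    AddSubgroup.map ((A.thetaH1 (Sum.inr v)).comp (cd.transportH1 ((W.baseChange K).torsionGaloisModule (p : ℤ)) v))
        ((hbar.propagateStructure (κ.eisensteinSelmerStructure
          (fun j ↦ (W.baseChange K).torsionGaloisModule ((p : ℤ) ^ j)) (fun j ↦ (W.baseChange K).torsionGaloisModuleReduce p j)
          hm S (fun v _ ↦ (W.baseChange K).ordinaryFiltrationAt v (fun j ↦ (W.baseChange K).torsionGaloisModuleReduce p j)
            (fun _ _ ↦ rfl)) 1)) (Sum.inr (cd.σ • v))) =
      (hbar.propagateStructure (κ.eisensteinSelmerStructure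
          (fun j ↦ (W.baseChange K).torsionGaloisModule ((p : ℤ) ^ j)) (fun j ↦ (W.baseChange K).torsionGaloisModuleReduce p j)
          hm S (fun v _ ↦ (W.baseChange K).ordinaryFiltrationAt v (fun j ↦ (W.baseChange K).torsionGaloisModuleReduce p j)
            (fun _ _ ↦ rfl)) 1)) (Sum.inr v) := by
  have hpK : (p : K) ≠ 0 := Nat.cast_ne_zero.2 hp.out.ne_zero
  have htt := (W.baseChange K).torsionGaloisModule_transition_hypotheses
    (fun j ↦ (W.baseChange K).torsionGaloisModuleReduce p j) (fun j P ↦ (W.baseChange K).coe_torsionGaloisModuleReduce p j P)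
  let X₁ : EisensteinCoeff p m 1 := Ideal.Quotient.mk _ PowerSeries.X
  -- the inclusion `j = ×[T]^{m-1} : E[p] ↪ E[p] ⊗ A_{m,1}`
  have hlin : (κ.eisensteinTwist ((W.baseChange K).torsionGaloisModule ((p : ℤ) ^ 1)) hm 1).IsScalarLinear
      (EisensteinCoeff p m 1) :=
    fun g d x ↦ κ.eisensteinTwist_apply_smul _ hm 1 g d x
  have hker : ∀ x, πbar x = 0 → (X₁ ^ (m - 1)) • x = 0 := by
    intro x hx
    have hx' : x ∈ LinearMap.ker πbar := hx
    rw [hbar.ker_eq, EisensteinCoeff.maximalIdeal_eisensteinCoeff_eq p hm (le_refl 1)] at hx'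
    clear hx
    induction hx' using Submodule.smul_induction_on' with
    | smul d hd y _ =>
      obtain ⟨a, rfl⟩ := Ideal.mem_span_singleton'.mp hd
      rw [smul_smul, ← mul_assoc, mul_comm _ a, mul_assoc, EisensteinCoeff.mk_X_pow_pred_mul_mk_X p hm, mul_zero,
        zero_smul]
    | add x y _ _ hx hy => rw [smul_add, hx, hy, add_zero]
  obtain ⟨jg, hjg⟩ := DiscreteGaloisModule.exists_intertwining_apply_eq_smul
    (ρ := κ.eisensteinTwist ((W.baseChange K).torsionGaloisModule ((p : ℤ) ^ 1)) hm 1)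
    (ρN := (W.baseChange K).torsionGaloisModule (p : ℤ)) hlin πbar.toAddMonoidHom hbar.surjective
    (fun g x ↦ hbar.equivariant g x) (X₁ ^ (m - 1)) hker
  have hjg' : ∀ x, jg (πbar x) = (X₁ ^ (m - 1)) • x := hjg
  -- the `G_ℚ`-structure `Θ` of the bottom level, over `τ_*` on `E[p^1]`
  let θ₁ : geomTorsion (W.baseChange K) ((p : ℤ) ^ 1) →+ geomTorsion (W.baseChange K) ((p : ℤ) ^ 1) :=
    cd.isLift.torsionMap W ((p : ℤ) ^ 1)
  have hθ₁ : ∀ (g : absoluteGaloisGroup K) (a : geomTorsion (W.baseChange K) ((p : ℤ) ^ 1)),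
      θ₁ ((W.baseChange K).torsionGaloisModule ((p : ℤ) ^ 1) (cd.conj g) a) =
        (W.baseChange K).torsionGaloisModule ((p : ℤ) ^ 1) g (θ₁ a) := fun g a ↦ by
    rw [torsionGaloisModule_apply_apply, torsionGaloisModule_apply_apply]
    exact cd.isLift.torsionMap_smul W _ g a
  have hθ₁inv : ∀ a, θ₁ (θ₁ a) = a := fun P ↦ by
    apply Subtype.ext
    change cd.isLift.pointsMap W (cd.isLift.pointsMap W (P : geomPoints (W.baseChange K))) = P
    generalize (P : geomPoints (W.baseChange K)) = Q
    change ((W.baseChange K).baseChange (AlgebraicClosure K)).toAffine.Point at Q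
    rcases Q with _ | ⟨x, y, h⟩
    · rfl
    · exact Affine.Point.some_eq_some_of_eq (cd.involutive x) (cd.involutive y)
  obtain ⟨ι₁, Θ, -, hΘ, hΘeq, hΘinv, hΘtop, hε⟩ :=
    κ.exists_bottomConj hm ((W.baseChange K).torsionGaloisModule ((p : ℤ) ^ 1)) cd.conj hanti θ₁ hθ₁
  -- `π̄ ∘ Θ = (−1)^{m-1} · θ ∘ π̄`
  have hπΘ : ∀ x, πbar (Θ x) = ((-1 : ℤ) ^ (m - 1)) • A.θ (πbar x) := by
    intro x
    induction x using EisensteinCoeff.Twisted.induction_on with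
    | zero => rw [map_zero, map_zero, map_zero, smul_zero]
    | tmul d a =>
      have hR : A.θ (πbar (EisensteinCoeff.Twisted.tmul d a)) =
          (EisensteinCoeff.residueChar p hm (le_refl 1) d).val • A.θ (πbar (EisensteinCoeff.Twisted.tmul 1 a)) := by
        rw [show EisensteinCoeff.Twisted.tmul d a = d • EisensteinCoeff.Twisted.tmul (1 : EisensteinCoeff p m 1) a by
          rw [EisensteinCoeff.Twisted.smul_tmul, mul_one], map_smul, hN, map_nsmul]
      rw [hΘ, map_zsmul, hR, ← mul_one (ι₁ d), ← EisensteinCoeff.Twisted.smul_tmul, map_smul, hN, hε, hone]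
    | add x y hx hy => rw [map_add, map_add, hx, hy, map_add, map_add, smul_add]
  have hΘj : ∀ n, Θ (jg n) = jg (A.θ n) := by
    intro n
    obtain ⟨x, rfl⟩ := hbar.surjective n
    have h1 : A.θ (πbar x) = ((-1 : ℤ) ^ (m - 1)) • πbar (Θ x) := by
      rw [hπΘ, smul_smul, ← pow_add, ← two_mul, pow_mul, neg_one_sq, one_pow, one_smul]
    change Θ (jg (πbar x)) = jg (A.θ (πbar x))
    rw [h1, map_zsmul, hjg', hjg' (Θ x), hΘtop]
  -- the two kernel identities (A2) at `v` and at `σ v`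
  have hkerw : ∀ w ∈ ({v, cd.σ • v} : Set (HeightOneSpectrum (𝓞 K))), ((p : ℕ) : 𝓞 K) ∉ w.asIdeal → w ∈ S →
      hbar.propagateStructure (κ.eisensteinSelmerStructure
          (fun j ↦ (W.baseChange K).torsionGaloisModule ((p : ℤ) ^ j)) (fun j ↦ (W.baseChange K).torsionGaloisModuleReduce p j)
          hm S (fun v _ ↦ (W.baseChange K).ordinaryFiltrationAt v (fun j ↦ (W.baseChange K).torsionGaloisModuleReduce p j)
            (fun _ _ ↦ rfl)) 1) (Sum.inr w) =
        (galoisCohomology.map (DiscreteGaloisModule.localMap jg (Sum.inr w)) 1).ker :=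
    fun w hw hpw hwS ↦ κ.propagate_eisensteinSelmerStructure_one_eq_ker
      (fun j ↦ (W.baseChange K).torsionGaloisModule ((p : ℤ) ^ j)) (fun j ↦ (W.baseChange K).torsionGaloisModuleReduce p j)
      hm htt.1 htt.2.1 htt.2.2 (fun k ↦ ((W.baseChange K).nonempty_geomTorsion_prime_pow_addEquiv_fin_two hpK k).some) S
      (fun v _ ↦ (W.baseChange K).ordinaryFiltrationAt v (fun j ↦ (W.baseChange K).torsionGaloisModuleReduce p j)
        (fun _ _ ↦ rfl)) hN ((W.baseChange K).torsionGaloisModule (p : ℤ)) πbar hbar jg hjg w hpw hwS (hUT w hw) (hSB w hw)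
  exact hbar.map_thetaH1_comp_transportH1_propagateStructure_eq_of_ker A _ jg Θ hΘeq
    (Function.Involutive.bijective (hΘinv hθ₁inv)) hΘj
    (hkerw v (by simp) hpv hvS) (hkerw (cd.σ • v) (by simp) hpσv hσvS)

set_option maxHeartbeats 800000 in
set_option synthInstance.maxHeartbeats 80000 in
/-- **H.5(b), bottom level, at `v ∈ S` away from `p`, under (UT) and (SB), for the curve's Eisenstein setting
`WeierstrassCurve.eisensteinDVRSetting`** (the `hfin` clause of `eisensteinDVRSetting_h5b_of` at `k = 0`, for any
conjugation datum `cd` for which `κ` is anticyclotomic): if at `w = v` and `w = σ v` the local towers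
`H¹(K_w, E[p^j] ⊗ A_{m,j}(ψ))` are killed by `p^c` for all `j` and the `Γ_{K_w}`-invariants of `E[p^j] ⊗ A_{m,j}(ψ)` are
killed by `[T]^{m-1}` for all `j`, then `(θ_v ∘ transport_v) (F̄_𝔮(σ v)) = F̄_𝔮(v)` at tower level `0`.
[cite: Howard2004HeegnerKolyvagin, §1.3 H.5(b) and Def. 3.1.2 (arXiv:1202.6340 p. 7 L96–97, p. 15 L99–108)]
[cite: MazurRubinMemoirs2004, Def. 1.1.1 and Example 1.1.2] -/
theorem eisensteinDVRSetting_h5b_clause_zero_of_mem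
    (hanti : ∀ g : absoluteGaloisGroup K, (κ (cd.conj g)).toAdd = -(κ g).toAdd)
    {v : HeightOneSpectrum (𝓞 K)} (hvS : v ∈ S) (hpv : ((p : ℕ) : 𝓞 K) ∉ v.asIdeal) (hσvS : cd.σ • v ∈ S)
    (hpσv : ((p : ℕ) : 𝓞 K) ∉ (cd.σ • v).asIdeal) {c : ℕ}
    (hUT : ∀ w ∈ ({v, cd.σ • v} : Set (HeightOneSpectrum (𝓞 K))), ∀ (j : ℕ)
      (y : galoisCohomology ((κ.eisensteinTwist ((W.baseChange K).torsionGaloisModule ((p : ℤ) ^ j)) hm j).toLocal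
        (Sum.inr w)) 1), p ^ c • y = 0)
    (hSB : ∀ w ∈ ({v, cd.σ • v} : Set (HeightOneSpectrum (𝓞 K))), ∀ (j : ℕ)
      (x : EisensteinCoeff.Twisted p m j (geomTorsion (W.baseChange K) ((p : ℤ) ^ j))),
      (∀ g : absoluteGaloisGroup (w.adicCompletion K),
        ((κ.eisensteinTwist ((W.baseChange K).torsionGaloisModule ((p : ℤ) ^ j)) hm j).toLocal (Sum.inr w)) g x = x) →
        ((Ideal.Quotient.mk _ PowerSeries.X : EisensteinCoeff p m j) ^ (m - 1)) • x = 0) :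
    letI := IwasawaAlgebra.isDomain_quotient_X_pow_add_C p hm
    letI := IwasawaAlgebra.isDiscreteValuationRing_quotient_X_pow_add_C p hm
    haveI := IwasawaAlgebra.EisensteinCoeff.isLocalRing_succ p hm
    letI := IwasawaAlgebra.EisensteinCoeff.algebraOfSpecSucc p m
    haveI := W.isScalarTower_algebraOfSpecSucc (K := K) (p := p) (m := m)
    letI := W.residueModuleSucc (K := K) (p := p) hm
    AddSubgroup.map
        (((W.residualTauGeomTorsion (p := p) cd hm (k := 0 + 1) (Nat.succ_pos 0)).thetaH1 (Sum.inr v)).comp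
          (cd.transportH1 ((W.baseChange K).torsionGaloisModule (p : ℤ)) v))
        (((W.isQuotientBy_eisensteinDVRSetting_πbar κ hm S hpS hbad L hL hLS jbar cd D fs 0).propagateStructure
          (W.eisensteinTowerTriple κ hm S hpS hbad L hL hLS 0).cond) (Sum.inr (cd.σ • v))) =
      ((W.isQuotientBy_eisensteinDVRSetting_πbar κ hm S hpS hbad L hL hLS jbar cd D fs 0).propagateStructure
        (W.eisensteinTowerTriple κ hm S hpS hbad L hL hLS 0).cond) (Sum.inr v) := by
  letI := IwasawaAlgebra.isDomain_quotient_X_pow_add_C p hm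
  letI := IwasawaAlgebra.isDiscreteValuationRing_quotient_X_pow_add_C p hm
  haveI := IwasawaAlgebra.EisensteinCoeff.isLocalRing_succ p hm
  letI := IwasawaAlgebra.EisensteinCoeff.algebraOfSpecSucc p m
  haveI := W.isScalarTower_algebraOfSpecSucc (K := K) (p := p) (m := m)
  letI := W.residueModuleSucc (K := K) (p := p) hm
  refine W.eisensteinSelmerStructure_h5b_clause_one_of_mem κ hm S cd
    (fun d n ↦ EisensteinCoeff.residueModule_smul p hm (Nat.succ_pos 0) _ d n) _
    (W.isQuotientBy_eisensteinDVRSetting_πbar κ hm S hpS hbad L hL hLS jbar cd D fs 0)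
    (W.residualTauGeomTorsion (p := p) cd hm (k := 0 + 1) (Nat.succ_pos 0)) (fun a ↦ ?_) hanti hvS hpv hσvS hpσv hUT hSB
  -- `π̄(1 ⊗ τ_* a) = τ_* (π̄ (1 ⊗ a))` on points
  apply Subtype.ext
  refine (W.coe_eisensteinDVRSetting_πbar_tmul κ hm S hpS hbad L hL hLS jbar cd D fs 0
    (cd.isLift.torsionMap W ((p : ℤ) ^ 1) a)).trans ?_
  have h2 : ((((W.eisensteinDVRSetting κ hm S hpS hbad L hL hLS jbar cd D fs).πbar 0
      (EisensteinCoeff.Twisted.tmul 1 a) : geomTorsion (W.baseChange K) (p : ℤ)) : geomPoints (W.baseChange K))) =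
      (a : geomPoints (W.baseChange K)) := by
    have h := W.coe_eisensteinDVRSetting_πbar_tmul κ hm S hpS hbad L hL hLS jbar cd D fs 0 a
    rwa [pow_zero, one_smul] at h
  rw [W.residualTauGeomTorsion_θ_apply (p := p) cd hm (Nat.succ_pos 0), IsLiftOfAut.coe_torsionMap,
    IsLiftOfAut.coe_torsionMap, pow_zero, one_smul]
  exact (congrArg (cd.isLift.pointsMap W) h2).symm

end WeierstrassCurve

end
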